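import Summits.Ventures.CertifiedManyBodySolver.Observables.StiffnessThermalLeafAtBeta
import Literature.MathematicalPhysics.QuantumLattice.HubbardTTPrimeThermalPressureLimit
import HarnessLib

/-!
# Ventures/CertifiedManyBodySolver — Observables/ThermalRungLeaves.lean (MO-S3 «thermal certificates» rung leaves, D-0154 (1))

HONEST FRAMING: one-sided CEILINGS on a Kosterlitz–Thouless transition temperature of the one-band square-lattice Hubbard model under the
THERMAL KT DICTIONARY (`ThermalKTDictionaryAt`: Nelson–Kosterlitz stability K2 and the thermal identification K1t are HYPOTHESES; NO
monotonicity K3), plus a certified thermal free-energy WINDOW; a ceiling never asserts superconductivity; NO lower bound on `T_c` is claimed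
anywhere; `1/10·t` is ≈ 465 K on La₂CuO₄ object E (`t_eff ≤ 0.40 eV`), ≈ 15× the cuprate scale. Cell `pub/hubbard-tc` (MO-S3 ORDER → `T_c`
back-end), filed on the lead's word (hubbard-tc-lead g9 RULING R112, 2026-08-28) for director-hubbard's D-0154 (1) line «THERMAL CERTIFICATES»
(route «hubbard-tc-thermcert-1», `Theses/TcThermcert1.lean`). Zero compute; no certificate; no `sorry`; no instance / notation.

**LEAVES = closed `Prop`s stating the rung's TARGETS** (same grammar as `Observables/RungLeaves.lean`, D-0061), so that the director's rung
table and a D-0059 route's `--closes-target` can point at ONE Lean name: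
* `S3ThermalTcCeilingRayAt_n7o8_tp0 θ` / **`S3ThermalTcTenthRay_n7o8_tp0`** (`θ = 1/10`): for EVERY `U ≥ 79/10`, every profile `ρₑ` and candidate
  transition temperature `Tc` satisfying `ThermalKTDictionaryAt 0 U (7/8) ρₑ Tc` has `Tc ≤ θ` (tree units `t = k_B = 1`). TODAY (TC-TABLE v0.7.148):
  `θ = 10/33` typed-conditional on CERTIFIED #536 ∧ #529 ∧ the C3(10/3) claim node (`tKT_n7o8_tp0_le_10o33_r536_r529_C3node_kernelQuad_b33o10_of_le_U79`);
  hypothesis-free `θ = 1/π` (`ThermalKTDictionaryAt.le_inv_pi_kinematic`). `1/10` is the first D-0154 rung (×3.03 below 10/33). The socket a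
  CERTIFICATE feeds is the SINGLE-TEMPERATURE one (`S3ThermalTcCeilingRayAt_n7o8_tp0_of_leafAtBeta`: a leaf `ObsThermalStiffnessSeqCeilingAtBeta 0 U (7/8) β c`
  on the ray with `(π/4)·c < 1/β ≤ θ`, via `ThermalKTDictionaryAt.le_inv_of_leafAtBeta` — no monotonicity, no T-grid); by hubbard-tc-mod-2's price sheet
  (HOME/hubbard-tc-mod-2/THERMCERT-KT-PRICES.md v1) every ENERGY-type certificate saturates at `θ* = 0.2011`, so `θ = 1/10` is a CURRENT–CURRENT certificate
  at `β·t = 10` (e.g. the odd-moment socket `ObsThermalStiffnessSeqCeilingAtBeta_of_torusLimit_oddMoment_le`).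
* `S3ThermalFreeEnergyWindowAt_U8_b8 w` / **`S3ThermalFreeEnergyWindow_U8_b8_le_1o50`** (`w = 1/50`): a certified two-sided window of width `≤ w` on the
  thermodynamic-limit free energy per site `f = −p(8; 1, 0, 8; 7/8)/8` at `β·t = 8`, `(U, n, t′) = (8, 7/8, 0)` (`p = pressureTT'`, the canonical
  `(rectN (7/8) L, S^z = 0)` free entropy per site). TODAY: floor side only (C3 3×3 node at `β·t = 8`: `p ≥ 5719046656893/2⁴⁰`, producer-certified).
* **`S3ThermalRung1_n7o8_tp0`** = the conjunction of the two (the route's `--closes-target`).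
References: HazraVermaRanderia2019 eqs. (2)–(4); NelsonKosterlitz1977 eq. (1); ScalapinoWhiteZhang1993 §II; Israel1979 Thm. I.2.4.
-/

noncomputable section

namespace Summit.Ventures.CertifiedManyBodySolver.Observables.ThermalRungLeaves

open Real
open Summit.Ventures.CertifiedManyBodySolver.Observables
open Literature.MathematicalPhysics.QuantumLattice.ThermodynamicLimit

/-! ## Leaf 1 — the thermal KT `T_c` ceiling on the ray `U ≥ 79/10` at `(7/8, 0)` -/

/-- **Thermal KT `T_c` ceiling `θ` on the ray `U ≥ 79/10` at `(n, t′) = (7/8, 0)`**: every pair (profile, candidate `Tc`) satisfying the thermal KT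
dictionary at `(U, 7/8, 0)` has `Tc ≤ θ`, for every `U ≥ 79/10`. [cite: HazraVermaRanderia2019, eqs. (2)–(4)] -/
def S3ThermalTcCeilingRayAt_n7o8_tp0 (θ : ℚ) : Prop :=
  ∀ U : ℝ, 79 / 10 ≤ U → ∀ (ρe : ℝ → ℝ) (Tc : ℝ), ThermalKTDictionaryAt 0 U (7 / 8) ρe Tc → Tc ≤ ((θ : ℚ) : ℝ)

/-- **LEAF `S3ThermalTcTenthRay_n7o8_tp0`** = the ceiling `1/10` (D-0154 (1) rung 1). OPEN at filing. [cite: NelsonKosterlitz1977, eq. (1)] -/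
@[conjecture] def S3ThermalTcTenthRay_n7o8_tp0 : Prop :=
  S3ThermalTcCeilingRayAt_n7o8_tp0 (1 / 10)

/-- Monotone transport of the ray ceiling. -/
theorem S3ThermalTcCeilingRayAt_n7o8_tp0_mono {θ θ' : ℚ} (h : S3ThermalTcCeilingRayAt_n7o8_tp0 θ) (hθ : θ ≤ θ') :
    S3ThermalTcCeilingRayAt_n7o8_tp0 θ' :=
  fun U hU ρe Tc hT => (h U hU ρe Tc hT).trans (by exact_mod_cast hθ)

/-- **A thermal stiffness leaf on the ray closes the ray ceiling at `(π/4)·c ≤ θ`** (`ThermalKTDictionaryAt.le_pi_div_four_mul`; no monotonicity,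
no claim node inside). [cite: HazraVermaRanderia2019, eqs. (2)–(3)] -/
theorem S3ThermalTcCeilingRayAt_n7o8_tp0_of_leaf {c θ : ℚ} (hcθ : π / 4 * ((c : ℚ) : ℝ) ≤ ((θ : ℚ) : ℝ))
    (hleaf : ∀ U : ℝ, 79 / 10 ≤ U → ObsThermalStiffnessSeqCeilingAt 0 U (7 / 8) c) :
    S3ThermalTcCeilingRayAt_n7o8_tp0 θ :=
  fun U hU _ _ hT => (hT.le_pi_div_four_mul (hleaf U hU)).trans hcθ

/-- **A single-temperature thermal stiffness leaf on the ray closes the ray ceiling** at every `θ ≥ 1/β` once `(π/4)·c < 1/β`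
(`ThermalKTDictionaryAt.le_inv_of_leafAtBeta`: the Nelson–Kosterlitz stability inequality at the one point `T = 1/β` is contradicted; no
monotonicity, no window). This is the socket a certified T > 0 current–current / kinetic word at ONE `β` feeds. [cite: HazraVermaRanderia2019, eqs. (2)–(3)] -/
theorem S3ThermalTcCeilingRayAt_n7o8_tp0_of_leafAtBeta {β : ℝ} (hβ : 0 < β) {c θ : ℚ} (hlt : π / 4 * ((c : ℚ) : ℝ) < 1 / β)
    (hθ : 1 / β ≤ ((θ : ℚ) : ℝ)) (hleaf : ∀ U : ℝ, 79 / 10 ≤ U → ObsThermalStiffnessSeqCeilingAtBeta 0 U (7 / 8) β c) :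
    S3ThermalTcCeilingRayAt_n7o8_tp0 θ :=
  fun U hU _ _ hT => (hT.le_inv_of_leafAtBeta hβ (hleaf U hU) hlt).trans hθ

/-- **Rung-1 instance of the single-temperature socket**: a leaf `9/71` at `β·t = 10` on the ray gives the tenth-ray ceiling
(`(π/4)·(9/71) = 0.0996 < 1/10`, `Real.pi_lt_d2`). [cite: HazraVermaRanderia2019, eqs. (2)–(3)] -/
theorem S3ThermalTcTenthRay_n7o8_tp0_of_leafAtBeta_ten
    (hleaf : ∀ U : ℝ, 79 / 10 ≤ U → ObsThermalStiffnessSeqCeilingAtBeta 0 U (7 / 8) 10 (9 / 71)) : S3ThermalTcTenthRay_n7o8_tp0 := by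
  refine S3ThermalTcCeilingRayAt_n7o8_tp0_of_leafAtBeta (by norm_num) ?_ (by push_cast; norm_num) hleaf
  have hπ : Real.pi < 3.15 := Real.pi_lt_d2
  push_cast
  nlinarith

/-- TODAY's hypothesis-free instance: the ray ceiling holds at every rational `θ ≥ 1/π` (kinematic thermal leaf,
`ThermalKTDictionaryAt.le_inv_pi_kinematic`). [cite: HazraVermaRanderia2019, App. G] -/
theorem S3ThermalTcCeilingRayAt_n7o8_tp0_of_inv_pi_le {θ : ℚ} (hθ : 1 / π ≤ ((θ : ℚ) : ℝ)) :
    S3ThermalTcCeilingRayAt_n7o8_tp0 θ :=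
  fun _ _ _ _ hT => (hT.le_inv_pi_kinematic (by norm_num) (by norm_num)).trans hθ

/-! ## Leaf 2 — a certified thermal free-energy window at `β·t = 8`, `(8, 7/8, 0)` -/

/-- **A certified two-sided window of width `≤ w` on the thermodynamic-limit free energy per site** `f = −p(8; 1, 0, 8; 7/8)/8` at `β·t = 8`,
`(U, n, t′) = (8, 7/8, 0)`: `∃ lo hi : ℚ, hi − lo ≤ w ∧ lo ≤ f ≤ hi`. [cite: Israel1979, Thm. I.2.4] -/
def S3ThermalFreeEnergyWindowAt_U8_b8 (w : ℚ) : Prop :=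
  ∃ lo hi : ℚ, hi - lo ≤ w ∧
    ((lo : ℚ) : ℝ) ≤ -(pressureTT' 8 1 0 8 (7 / 8)) / 8 ∧ -(pressureTT' 8 1 0 8 (7 / 8)) / 8 ≤ ((hi : ℚ) : ℝ)

/-- **LEAF `S3ThermalFreeEnergyWindow_U8_b8_le_1o50`** = width `≤ 1/50` (the venture's M2 tolerance `M2Width` transplanted to `T > 0`). OPEN at filing.
[cite: Israel1979, Thm. I.2.4] -/
@[conjecture] def S3ThermalFreeEnergyWindow_U8_b8_le_1o50 : Prop :=
  S3ThermalFreeEnergyWindowAt_U8_b8 (1 / 50)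

/-- Monotone in the width. -/
theorem S3ThermalFreeEnergyWindowAt_U8_b8_mono {w w' : ℚ} (h : S3ThermalFreeEnergyWindowAt_U8_b8 w) (hw : w ≤ w') :
    S3ThermalFreeEnergyWindowAt_U8_b8 w' := by
  obtain ⟨lo, hi, hwid, hlo, hhi⟩ := h
  exact ⟨lo, hi, hwid.trans hw, hlo, hhi⟩

/-! ## Leaf 3 — the rung = the conjunction (route «hubbard-tc-thermcert-1»'s `--closes-target`) -/

/-- **LEAF `S3ThermalRung1_n7o8_tp0`** = `S3ThermalTcTenthRay_n7o8_tp0 ∧ S3ThermalFreeEnergyWindow_U8_b8_le_1o50` (MO-S3 «thermal certificates» rung 1,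
D-0154 (1)). OPEN at filing. [cite: HazraVermaRanderia2019, eqs. (2)–(4)] -/
@[conjecture] def S3ThermalRung1_n7o8_tp0 : Prop :=
  S3ThermalTcTenthRay_n7o8_tp0 ∧ S3ThermalFreeEnergyWindow_U8_b8_le_1o50

/-- The rung from its two leaves. -/
theorem S3ThermalRung1_n7o8_tp0_of (h₁ : S3ThermalTcTenthRay_n7o8_tp0) (h₂ : S3ThermalFreeEnergyWindow_U8_b8_le_1o50) :
    S3ThermalRung1_n7o8_tp0 :=
  ⟨h₁, h₂⟩

/-! ## Leaf 1-box (APPEND, hubbard-tc-lead g9 RULING R121, 2026-08-28; seat hubbard-tc-mod-2 g17) — the thermal KT `T_c` ceiling on the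
La₂CuO₄ object-E `U`-BOX `79/10 ≤ U ≤ 147/10` at `(7/8, 0)`

WHY THE BOX (R121, numbers from hubbard-tc-mod-2's sizing, floats): the ray leaf above quantifies over every `U ≥ 79/10`; the cell's kinetic-class
rows are ray-shaped only because the double occupancy and the pressure are ANTITONE in `U`, a monotonicity a certified current–current word does not
have, and on the far ray the energy class alone gives `θ(U) = 0.300 (U = 8) · 0.277 (14.7) · 0.201 (50) · 0.163 (U → ∞)` — never `1/10`. So the
rung's `T_c` face for the D-0154 line is the BOX twin below (implied by the ray leaf; the object-E box of TC-TABLE), and route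
«hubbard-tc-thermcert-1» closes `S3ThermalTcTenthBox_n7o8_tp0`. Shapes fixed verbatim by R121; bodies pre-checked by the lead
(`v4draft/Scratch_box_local.lean` 61e9b2e78202485d). The three leaves of the first filing are untouched. -/

/-- **Thermal KT `T_c` ceiling `θ` on the BOX `79/10 ≤ U ≤ 147/10` at `(n, t′) = (7/8, 0)`**: every pair (profile, candidate `Tc`) satisfying the thermal
KT dictionary at `(U, 7/8, 0)` has `Tc ≤ θ`, for every `U` in the box. [cite: HazraVermaRanderia2019, eqs. (2)–(4)] -/
def S3ThermalTcCeilingBoxAt_n7o8_tp0 (θ : ℚ) : Prop :=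
  ∀ U : ℝ, 79 / 10 ≤ U → U ≤ 147 / 10 → ∀ (ρe : ℝ → ℝ) (Tc : ℝ), ThermalKTDictionaryAt 0 U (7 / 8) ρe Tc → Tc ≤ ((θ : ℚ) : ℝ)

/-- **LEAF `S3ThermalTcTenthBox_n7o8_tp0`** = the box ceiling `1/10` (D-0154 (1) rung 1, BOX form, route «hubbard-tc-thermcert-1»'s `--closes-target`
per R121). OPEN at filing. [cite: NelsonKosterlitz1977, eq. (1)] -/
@[conjecture] def S3ThermalTcTenthBox_n7o8_tp0 : Prop :=
  S3ThermalTcCeilingBoxAt_n7o8_tp0 (1 / 10)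

/-- The ray ceiling implies the box ceiling (the box is a segment of the ray). [cite: HazraVermaRanderia2019, eqs. (2)–(4)] -/
theorem S3ThermalTcCeilingBoxAt_n7o8_tp0_of_ray {θ : ℚ} (h : S3ThermalTcCeilingRayAt_n7o8_tp0 θ) :
    S3ThermalTcCeilingBoxAt_n7o8_tp0 θ :=
  fun U hU _ ρe Tc hT => h U hU ρe Tc hT

/-- Monotone transport of the box ceiling. [cite: HazraVermaRanderia2019, eqs. (2)–(4)] -/
theorem S3ThermalTcCeilingBoxAt_n7o8_tp0_mono {θ θ' : ℚ} (h : S3ThermalTcCeilingBoxAt_n7o8_tp0 θ) (hθ : θ ≤ θ') :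
    S3ThermalTcCeilingBoxAt_n7o8_tp0 θ' :=
  fun U hU hU' ρe Tc hT => (h U hU hU' ρe Tc hT).trans (by exact_mod_cast hθ)

/-- **A single-temperature thermal stiffness leaf ON THE BOX closes the box ceiling** at every `θ ≥ 1/β` once `(π/4)·c < 1/β`
(`ThermalKTDictionaryAt.le_inv_of_leafAtBeta` at the one point `T = 1/β`; no monotonicity, no window) — the socket a certified `T > 0`
current–current word at ONE `β`, transported over the box only, feeds. [cite: HazraVermaRanderia2019, eqs. (2)–(3)] -/
theorem S3ThermalTcCeilingBoxAt_n7o8_tp0_of_leafAtBeta {β : ℝ} (hβ : 0 < β) {c θ : ℚ} (hlt : π / 4 * ((c : ℚ) : ℝ) < 1 / β)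
    (hθ : 1 / β ≤ ((θ : ℚ) : ℝ))
    (hleaf : ∀ U : ℝ, 79 / 10 ≤ U → U ≤ 147 / 10 → ObsThermalStiffnessSeqCeilingAtBeta 0 U (7 / 8) β c) :
    S3ThermalTcCeilingBoxAt_n7o8_tp0 θ :=
  fun U hU hU' _ _ hT => (hT.le_inv_of_leafAtBeta hβ (hleaf U hU hU') hlt).trans hθ

/-- **Rung-1 (box) instance of the single-temperature socket**: a leaf `9/71` at `β·t = 10` on the box gives the tenth-box ceiling
(`(π/4)·(9/71) = 0.0996 < 1/10`, `Real.pi_lt_d2`) — the v4 Assembly term is `fun h₁ h₂ => S3ThermalTcTenthBox_n7o8_tp0_of_leafAtBeta_ten (h₂ h₁)`.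
[cite: HazraVermaRanderia2019, eqs. (2)–(3)] -/
theorem S3ThermalTcTenthBox_n7o8_tp0_of_leafAtBeta_ten
    (hleaf : ∀ U : ℝ, 79 / 10 ≤ U → U ≤ 147 / 10 → ObsThermalStiffnessSeqCeilingAtBeta 0 U (7 / 8) 10 (9 / 71)) :
    S3ThermalTcTenthBox_n7o8_tp0 := by
  refine S3ThermalTcCeilingBoxAt_n7o8_tp0_of_leafAtBeta (by norm_num) ?_ (by push_cast; norm_num) hleaf
  have hπ : Real.pi < 3.15 := Real.pi_lt_d2
  push_cast
  nlinarith

/-- The tenth-ray leaf implies the tenth-box leaf. [cite: NelsonKosterlitz1977, eq. (1)] -/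
theorem S3ThermalTcTenthBox_n7o8_tp0_of_ray (h : S3ThermalTcTenthRay_n7o8_tp0) : S3ThermalTcTenthBox_n7o8_tp0 :=
  S3ThermalTcCeilingBoxAt_n7o8_tp0_of_ray h

/-- TODAY's hypothesis-free instance on the box: the box ceiling holds at every rational `θ ≥ 1/π` (kinematic thermal leaf, via the ray).
[cite: HazraVermaRanderia2019, App. G] -/
theorem S3ThermalTcCeilingBoxAt_n7o8_tp0_of_inv_pi_le {θ : ℚ} (hθ : 1 / π ≤ ((θ : ℚ) : ℝ)) :
    S3ThermalTcCeilingBoxAt_n7o8_tp0 θ :=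
  S3ThermalTcCeilingBoxAt_n7o8_tp0_of_ray (S3ThermalTcCeilingRayAt_n7o8_tp0_of_inv_pi_le hθ)

end Summit.Ventures.CertifiedManyBodySolver.Observables.ThermalRungLeaves
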